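import Summits.Langlands.Langlands.Theses.ParityBlindBianchi
import Summits.Langlands.Langlands.Theorems.ParityBlindBianchiResidualBianchiDoorLevel
import Summits.Langlands.Langlands.Theorems.ParityBlindBianchiIcosahedralDescentLevelMain
import Summits.Langlands.Langlands.Theorems.ParityBlindBianchiIcosahedralDescentLevelEquiv
import HarnessLib

/-!
# Line `DoorFromOwnChain` for crux stmt-Langlands-15113 `IcosahedralDescentLevel`: the forward wiring
# "route thesis E2′ ∧ R′ (+ seven printed facts) ⊢ the TYPED crux", kernel-checked

Lead prover, line `DoorFromOwnChain` (card `Cruxes/IcosahedralDescentLevel/Ideas/door-from-own-chain.md`),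
`--supports stmt-Langlands-15113`.

The crux AS TYPED is, with no hypothesis, the all-parity door
`GaloisWeightedBE.StrongArtinIcosahedralQ` (`iff_strongArtinIcosahedralQ`, p116764): a.e. strong Artin for
EVERY irreducible icosahedral `ρ : Γ_ℚ → GL₂(ℂ)`.  Line `Sketch` died there because its inputs (cyclic base
change / descent only) cannot CREATE automorphy of an insoluble-image representation.  This file records
the one line shape that is not dead on arrival: the route's OWN chain is parity-free, so its two open
cruxes E2′ `TwoAdicBianchiProModularityLevel` (stmt-Langlands-15110) and R′ `ArtinWeightRealisationLevel`
(stmt-Langlands-15111) — automorphy creation over `K` at the parity-blind prime `2` — feed the door, and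
hence the typed crux, for odd and even `ρ` alike:

* `artinAE_of_thesis` — given the seven printed named facts of the tree (Khare–Wintenberger for all
  `p`, used at `p = 2`; Arthur–Clozel Ch. 3: cuspidal cyclic base change, strong lifting at the
  archimedean / all finite / unramified places, cyclic descent, fibres of quadratic base change) and the
  two cruxes E2′, R′ as hypotheses, EVERY irreducible icosahedral `ρ/ℚ` has a cuspidal `π` on `GL₂(𝔸_ℚ)`
  with `satakePolynomial (t_{π,v}) = charpoly ρ(Frob_v)` at cofinitely many `v`.  Proof = the route's
  `closes` with the misstated links replaced by their landed repaired forms: over `ℚ`, `stub_qLevel`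
  (E1′ with a PRIME-ONLY bad set `S ∋ 2`, p-landed under `Cruxes.ResidualBianchiDoorLevel.Sketch`); per
  2-split imaginary quadratic `K`, `exists_padicModel_restrictField` + `stub_cuspWitness` +
  `stub_bcTransfer` (the residual rung over `K` at every place off `S`); then E2′ and R′ at `p = 2`; then
  the landed repaired descent `icosahedralDescentLevel_repaired` (D″, p111861; it needs `0 ∉ S`, which
  holds because `S` consists of primes).  The crux's own uniform-family hypothesis is never used.
* `icosahedralDescentLevel_of_thesis` — the TYPED crux from the same nine hypotheses;
  `stub_doorFromThesis` — the same, curried: the registered transfer stub of the line's skeleton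
  (`Cruxes/IcosahedralDescentLevel/Lines/DoorFromOwnChain.lean`), proved.
* `strongArtinIcosahedralQ_of_thesis` — the sibling route's rank-0 target stmt-Langlands-10841.
* `evenIcosahedralStrongArtin_of_thesis` — THIS route's rank-0 target stmt-Langlands-2903.
* `langlands_of_thesis` — the summit statement from the seven facts, E2′, R′ and the junction
  `EvenArtinJunction` only: a re-typed deciding theorem in which neither E1′ `ResidualBianchiDoorLevel`
  nor D′ `IcosahedralDescentLevel` (both misstated at `S₀ ∋ 0`) occurs — repair option (c) for the
  tenure planner.

Honest label: WIRING, no new mathematics; every hypothesis is either a printed theorem filed as a named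
fact of the tree (`proof.conditional` on exactly those seven names) or an open crux of this route.
-/

-- `Summit.Langlands.Langlands.…`: the repeated path component is the tree's layout (D-0017).
set_option linter.dupNamespace false

noncomputable section

open scoped MatrixGroups NumberField Polynomial Classical
open NumberField IsDedekindDomain Field Filter
open Literature.NumberTheory.Automorphic Literature.NumberTheory.GaloisRepresentations
open Summit.Langlands.Langlands.Theses.ParityBlindBianchi
open Summit.Langlands.Langlands.Theses.GaloisWeightedBE (StrongArtinIcosahedralQ)
open Summit.Langlands.Langlands.Cruxes.ResidualBianchiDoorLevel.Sketch
  (stub_qLevel stub_cuspWitness stub_bcTransfer framedGaloisRep_eq_of_toMonoidHom_eq)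

namespace Summit.Langlands.Langlands.Theorems.IcosahedralDescentLevel

/-- **The route's parity-free chain proves a.e. strong Artin for EVERY irreducible icosahedral `ρ/ℚ`**
(odd or even), modulo the seven printed named facts of the tree and the two open cruxes E2′
(`TwoAdicBianchiProModularityLevel`, stmt-Langlands-15110) and R′ (`ArtinWeightRealisationLevel`,
stmt-Langlands-15111) taken as hypotheses.  Over `ℚ`: `stub_qLevel` (Khare–Wintenberger at `p = 2`;
prime-only `S ∋ 2`, the entrywise model `σ₀ = GL₂(ι⁻¹) ∘ ρ`, a regular algebraic cuspidal `π_ℚ`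
congruent to `σ₀` off `S`).  Per 2-split imaginary quadratic `K`: `exists_padicModel_restrictField`
(`σ₀|_{Γ_K}`: finite image, irreducible, projectively `A₅`, entrywise `ι`-compatible with `ρ|_{Γ_K}`),
`stub_cuspWitness` + `stub_bcTransfer` (cuspidal base change + strong lifting: the residual rung over `K`
at EVERY place off `S`), then E2′ (2-adic Hecke point of tame level `S`) and R′ at `p = 2` (a cuspidal
`π_K` Satake–Frobenius compatible with `σ₀|_{Γ_K}` at every place off `S`).  Finally the landed repaired
descent `icosahedralDescentLevel_repaired` (`0 ∉ S` because `S` consists of primes). [folklore] -/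
theorem artinAE_of_thesis
    (hKW : ∀ (p : ℕ) [Fact p.Prime] (k : Type) [Field k] [TopologicalSpace k] [DiscreteTopology k],
      khare_wintenberger p k)
    (hBC : baseChange_cyclic_cuspidal) (hArch : ArthurClozel1989_strongLifting_archimedean)
    (hR1 : ArthurClozel1989_strongLifting_allFinite) (hdesc : cuspidal_descent_cyclic)
    (hSL : ArthurClozel1989_strongLifting_unramified) (hfib : ArthurClozel_fibres_quadratic)
    (hE2 : TwoAdicBianchiProModularityLevel) (hR : ArtinWeightRealisationLevel)
    (ι : PadicAlgCl 2 ≃+* ℂ) (ρ : FramedGaloisRep ℚ ℂ 2) (hirr : ρ.toGaloisRep.IsIrreducible)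
    (hA5 : Nonempty ((Matrix.ProjGenLinGroup.mk.comp ρ.toMonoidHom).range ≃*
      alternatingGroup (Fin 5))) :
    ∃ (hcpt : isCompact_glFiniteIntegralLevel 2 ℚ) (π : CuspidalAutomorphicRepData 2 ℚ hcpt),
      ∀ᶠ v : HeightOneSpectrum (𝓞 ℚ) in cofinite, ∃ α : Multiset ℂ,
        π.1.HasSatakeParamAt v α ∧ ρ.IsUnramifiedAt v ∧
          ρ.HasFrobCharpolyAt v (satakePolynomial α) := by
  -- E1′ over `ℚ`, with a PRIME-ONLY bad set `S ∋ 2`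
  obtain ⟨S, h2S, hS, σ₀, hσ₀, hcptQ, πQ, hRA, hgood⟩ := stub_qLevel hKW ι ρ hirr hA5
  have h0 : (0 : ℕ) ∉ S := fun h => Nat.not_prime_zero (hS 0 h)
  -- the repaired uniform descent D″ reduces the claim to the uniform family off `S`
  refine icosahedralDescentLevel_repaired hdesc hSL hBC hfib ι ρ S h0 ?_
  intro K _ _ htc hdeg hsplit
  -- the Galois side over `K`: the same `σ₀`, restricted to `Γ_K`
  obtain ⟨σ₀', hσ₀', hfin, hproj, hmodel, hfinK, hirrK, hA5K⟩ :=
    Summit.Langlands.Langlands.Theorems.ResidualBianchiDoorMod2.exists_padicModel_restrictField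
      ι ρ hA5 K hdeg
  obtain rfl : σ₀' = σ₀ := framedGaloisRep_eq_of_toMonoidHom_eq (hσ₀'.trans hσ₀.symm)
  -- the residual rung over `K` at every place off `S`
  obtain ⟨hcpt, π₀, hRA₀, hgood₀⟩ := stub_bcTransfer hBC hArch hR1 ι σ₀' S hcptQ πQ hRA hgood K hdeg
    (stub_cuspWitness ι σ₀' hfin hproj S hS hcptQ πQ hgood K hdeg)
  -- E2′ (2-adic pro-modularity at tame level `S`) feeds R′ (realisation at `p = 2`, level `S`)
  obtain ⟨hcpt', π, hπ⟩ := hR K htc hdeg 2 ι (σ₀'.restrictField K) hfinK hirrK S h2S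
    (hE2 K htc hdeg hsplit ι (σ₀'.restrictField K) hfinK hirrK hA5K S h2S ⟨hcpt, π₀, hRA₀, hgood₀⟩)
  exact ⟨σ₀'.restrictField K, hcpt', π, hmodel, hπ⟩

/-- **The TYPED crux from the route's own thesis** (line `DoorFromOwnChain`): modulo the seven printed
named facts, E2′ `TwoAdicBianchiProModularityLevel` and R′ `ArtinWeightRealisationLevel` imply
`IcosahedralDescentLevel` AS TYPED — its conclusion for `(ι, ρ)` is `artinAE_of_thesis`; its
uniform-family hypothesis (vacuous at `S₀ = {0}`) is not consumed. [folklore] -/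
theorem icosahedralDescentLevel_of_thesis
    (hKW : ∀ (p : ℕ) [Fact p.Prime] (k : Type) [Field k] [TopologicalSpace k] [DiscreteTopology k],
      khare_wintenberger p k)
    (hBC : baseChange_cyclic_cuspidal) (hArch : ArthurClozel1989_strongLifting_archimedean)
    (hR1 : ArthurClozel1989_strongLifting_allFinite) (hdesc : cuspidal_descent_cyclic)
    (hSL : ArthurClozel1989_strongLifting_unramified) (hfib : ArthurClozel_fibres_quadratic)
    (hE2 : TwoAdicBianchiProModularityLevel) (hR : ArtinWeightRealisationLevel) :
    IcosahedralDescentLevel :=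
  fun ι ρ hirr hA5 _ => artinAE_of_thesis hKW hBC hArch hR1 hdesc hSL hfib hE2 hR ι ρ hirr hA5

/-- **Registered transfer stub of the line's skeleton** (`Lines/DoorFromOwnChain.lean`, stub
`stub_doorFromThesis`, verbatim signature): the seven printed named facts, E2′ and R′ imply the TYPED
crux — `icosahedralDescentLevel_of_thesis` in curried form. [folklore] -/
theorem stub_doorFromThesis :
    (∀ (p : ℕ) [Fact p.Prime] (k : Type) [Field k] [TopologicalSpace k] [DiscreteTopology k],
      khare_wintenberger p k) →
    baseChange_cyclic_cuspidal → ArthurClozel1989_strongLifting_archimedean →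
    ArthurClozel1989_strongLifting_allFinite → cuspidal_descent_cyclic →
    ArthurClozel1989_strongLifting_unramified → ArthurClozel_fibres_quadratic →
    TwoAdicBianchiProModularityLevel → ArtinWeightRealisationLevel → IcosahedralDescentLevel :=
  fun hKW hBC hArch hR1 hdesc hSL hfib hE2 hR =>
    icosahedralDescentLevel_of_thesis hKW hBC hArch hR1 hdesc hSL hfib hE2 hR

/-- **The sibling route's open rank-0 target from this route's thesis**: modulo the seven printed named
facts, E2′ and R′ imply `GaloisWeightedBE.StrongArtinIcosahedralQ` (stmt-Langlands-10841: a.e. strong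
Artin for every irreducible icosahedral `ρ/ℚ`), through `iff_strongArtinIcosahedralQ`. [folklore] -/
theorem strongArtinIcosahedralQ_of_thesis
    (hKW : ∀ (p : ℕ) [Fact p.Prime] (k : Type) [Field k] [TopologicalSpace k] [DiscreteTopology k],
      khare_wintenberger p k)
    (hBC : baseChange_cyclic_cuspidal) (hArch : ArthurClozel1989_strongLifting_archimedean)
    (hR1 : ArthurClozel1989_strongLifting_allFinite) (hdesc : cuspidal_descent_cyclic)
    (hSL : ArthurClozel1989_strongLifting_unramified) (hfib : ArthurClozel_fibres_quadratic)
    (hE2 : TwoAdicBianchiProModularityLevel) (hR : ArtinWeightRealisationLevel) :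
    StrongArtinIcosahedralQ :=
  iff_strongArtinIcosahedralQ.mp (icosahedralDescentLevel_of_thesis hKW hBC hArch hR1 hdesc hSL hfib hE2 hR)

/-- **This route's rank-0 target from its thesis, without E1′ and D′**: modulo the seven printed named
facts, E2′ and R′ imply `EvenIcosahedralStrongArtin` (stmt-Langlands-2903); the evenness hypothesis is
not consumed. [folklore] -/
theorem evenIcosahedralStrongArtin_of_thesis
    (hKW : ∀ (p : ℕ) [Fact p.Prime] (k : Type) [Field k] [TopologicalSpace k] [DiscreteTopology k],
      khare_wintenberger p k)
    (hBC : baseChange_cyclic_cuspidal) (hArch : ArthurClozel1989_strongLifting_archimedean)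
    (hR1 : ArthurClozel1989_strongLifting_allFinite) (hdesc : cuspidal_descent_cyclic)
    (hSL : ArthurClozel1989_strongLifting_unramified) (hfib : ArthurClozel_fibres_quadratic)
    (hE2 : TwoAdicBianchiProModularityLevel) (hR : ArtinWeightRealisationLevel) :
    EvenIcosahedralStrongArtin :=
  evenIcosahedralStrongArtin_of_icosahedralDescentLevel'
    (icosahedralDescentLevel_of_thesis hKW hBC hArch hR1 hdesc hSL hfib hE2 hR)

/-- **Re-typed deciding theorem (repair option (c) for the tenure planner).**  The summit statement
from the seven printed named facts, the two open cruxes E2′, R′ and the junction `EvenArtinJunction`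
only: neither the misstated E1′ `ResidualBianchiDoorLevel` nor the misstated D′ `IcosahedralDescentLevel`
occurs, and no hypothesis is idle. [folklore] -/
theorem langlands_of_thesis
    (hKW : ∀ (p : ℕ) [Fact p.Prime] (k : Type) [Field k] [TopologicalSpace k] [DiscreteTopology k],
      khare_wintenberger p k)
    (hBC : baseChange_cyclic_cuspidal) (hArch : ArthurClozel1989_strongLifting_archimedean)
    (hR1 : ArthurClozel1989_strongLifting_allFinite) (hdesc : cuspidal_descent_cyclic)
    (hSL : ArthurClozel1989_strongLifting_unramified) (hfib : ArthurClozel_fibres_quadratic)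
    (hE2 : TwoAdicBianchiProModularityLevel) (hR : ArtinWeightRealisationLevel)
    (hJ : EvenArtinJunction) : _root_.Langlands :=
  hJ fun ρ hirr hA5 _heven =>
    evenIcosahedralStrongArtin_of_thesis hKW hBC hArch hR1 hdesc hSL hfib hE2 hR ρ hirr hA5 _heven

end Summit.Langlands.Langlands.Theorems.IcosahedralDescentLevel

end
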